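import Mathlib
import HarnessLib
import Literature.MathematicalPhysics.QuantumLattice.HubbardUVSymbolSmooth

/-!
# The ultraviolet symbol as a JOINTLY smooth function of (frequency, band): all mixed derivatives at once,
# `‖Dⁿ Ψ(ω, e)‖ ≤ c·B·(n+1)!·(2/m(ω))^{n+1}`, `m(ω) = max(|ω|, Λ/2)`

Topic `MathematicalPhysics/QuantumLattice`; companion of `HubbardUVSymbolSmooth` (there: `Ψ = uvSymbolFn c Λ e ω = χ₂((ω²+e²)/Λ²)·c/(-iω+e)`
and its first two derivatives in `ω` and in `e` SEPARATELY, by hand).  The first space-time MOMENT of the scale-`0` covariance on the time grid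
(cell gate-hubbard-kl, K3 engine, stub `stub_engine_scale0`, clause (E4)₀) needs MIXED derivatives `∂_ω^a ∂_e^b Ψ` up to total order `5`
(product-weight Plancherel with one time difference and up to three band differences, the latter telescoped over the frame pieces with one
extra `e`-derivative from the mean value theorem).  Here `Ψ` is read as ONE smooth function `uvSymbol₂ c Λ` on the Euclidean plane
`E₂ = EuclideanSpace ℝ (Fin 2)` (`x 0 = ω`, `x 1 = e`): `Ψ(x) = χ₂(‖x‖²/Λ²) · c · (A x)⁻¹` with the ℝ-linear isometry `A x = -i·x₀ + x₁ ∈ ℂ`, and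
its iterated Fréchet derivative is bounded in operator norm — which bounds every mixed partial derivative of that order:

* `uvLin` (`A`), `norm_uvLin_apply` (`‖A x‖ = ‖x‖`), `norm_uvLin_le_one`;
* `normSqDiv` (`Q x = ‖x‖²/Λ²`) with `norm_iteratedFDeriv_normSqDiv_le` (`‖DⁱQ x‖ ≤ (2/Λ)ⁱ` for `1 ≤ i`, `‖x‖ ≤ Λ`);
* `uvWeight₂ = χ₂ ∘ Q` with `norm_iteratedFDeriv_uvWeight₂_le_shell` (`≤ i!·B·(2/Λ)ⁱ` on `‖x‖ ≤ Λ`) and `iteratedFDeriv_uvWeight₂_eq_zero_of_lt/_gt`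
  (locally constant off the transition shell);
* `uvRes₂ = c·(A ·)⁻¹` with `norm_iteratedFDeriv_uvRes₂_le` (`≤ c·k!/‖x‖^{k+1}`, `x ≠ 0`; complex-analytic inverse read over `ℝ`,
  `ContDiffAt.restrictScalars_iteratedFDeriv`, `iter_deriv_inv`);
* `uvSymbol₂`, `uvSymbol₂_apply_eq_uvSymbolFn` (`Ψ(ω e) = uvSymbolFn c Λ e ω`), `contDiff_uvSymbol₂`;
* **`norm_iteratedFDeriv_uvSymbol₂_le`** — for `n ≤ N` and `B ≥ 1` bounding `|χ₂^{(i)}|`, `i ≤ N`: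
  `‖iteratedFDeriv ℝ n (uvSymbol₂ c Λ) x‖ ≤ c · B · (n+1)! · (2 / max |x 0| (Λ/2))^{n+1}` for EVERY `x`.

Everything is proved; the functions are the only definitions; no named facts.

## Sources

M. Salmhofer, *Renormalization* (1999), §4.2.5 (4.70)–(4.71) (`Salmhofer1999`); G. Benfatto, A. Giuliani, V. Mastropietro,
Ann. Henri Poincaré 7 (2006) 809–898, §2.1 (2.3), (2.36aa), §3 (3.2)–(3.8) (`BenfattoGiulianiMastropietro2006`).
-/

noncomputable section

namespace Literature.MathematicalPhysics.QuantumLattice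

open Literature.Probability.LatticeModels Set Complex Filter
open scoped Nat Topology

/-- The frequency–band plane `E₂ = ℝ²` (Euclidean): `x 0 = ω`, `x 1 = e`. [cite: Salmhofer1999, §4.2.5 (4.70)] -/
abbrev FreqBand : Type := EuclideanSpace ℝ (Fin 2)

/-! ### §1 The linear isometry `A x = -i x₀ + x₁` -/

/-- The ℝ-linear map `A(ω, e) = -iω + e ∈ ℂ` (the denominator of the free propagator). [cite: Salmhofer1999, §4.2.5 (4.70)] -/
def uvLin : FreqBand →L[ℝ] ℂ :=
  LinearMap.toContinuousLinearMap
    { toFun := fun x => -I * ((x 0 : ℝ) : ℂ) + ((x 1 : ℝ) : ℂ)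
      map_add' := fun x y => by simp only [PiLp.add_apply, ofReal_add]; ring
      map_smul' := fun r x => by
        simp only [PiLp.smul_apply, smul_eq_mul, ofReal_mul, RingHom.id_apply, real_smul]; ring }

/-- `A x = -i x₀ + x₁`. [cite: Salmhofer1999, §4.2.5 (4.70)] -/
theorem uvLin_apply (x : FreqBand) : uvLin x = -I * ((x 0 : ℝ) : ℂ) + ((x 1 : ℝ) : ℂ) := rfl

/-- `‖A x‖² = x₀² + x₁²`. [cite: Salmhofer1999, §4.2.5 (4.70)] -/
theorem norm_sq_uvLin_apply (x : FreqBand) : ‖uvLin x‖ ^ 2 = x 0 ^ 2 + x 1 ^ 2 := by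
  rw [uvLin_apply, Complex.sq_norm, Complex.normSq_apply]
  simp
  ring

/-- `‖x‖² = x₀² + x₁²` on `E₂`. [cite: Salmhofer1999, §4.2.5 (4.70)] -/
theorem norm_sq_freqBand (x : FreqBand) : ‖x‖ ^ 2 = x 0 ^ 2 + x 1 ^ 2 := by
  rw [EuclideanSpace.norm_sq_eq, Fin.sum_univ_two, Real.norm_eq_abs, Real.norm_eq_abs, sq_abs, sq_abs]

/-- **`A` is an isometry**: `‖A x‖ = ‖x‖`. [cite: Salmhofer1999, §4.2.5 (4.70)] -/
theorem norm_uvLin_apply (x : FreqBand) : ‖uvLin x‖ = ‖x‖ := by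
  have h : ‖uvLin x‖ ^ 2 = ‖x‖ ^ 2 := by rw [norm_sq_uvLin_apply, norm_sq_freqBand]
  exact (sq_eq_sq₀ (norm_nonneg _) (norm_nonneg _)).1 h

/-- `‖A‖ ≤ 1`. [cite: Salmhofer1999, §4.2.5 (4.70)] -/
theorem norm_uvLin_le_one : ‖uvLin‖ ≤ 1 :=
  ContinuousLinearMap.opNorm_le_bound _ zero_le_one fun x => by rw [norm_uvLin_apply, one_mul]

/-- `|x₀| ≤ ‖x‖`. [cite: Salmhofer1999, §4.2.5 (4.70)] -/
theorem abs_apply_zero_le_norm (x : FreqBand) : |x 0| ≤ ‖x‖ := by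
  have h := norm_sq_freqBand x
  nlinarith [sq_nonneg (x 1), norm_nonneg x, abs_nonneg (x 0), sq_abs (x 0)]

/-! ### §2 The scaled squared norm `Q x = ‖x‖²/Λ²` and its derivatives -/

/-- `Q x = ‖x‖²/Λ²` (the argument of the cutoff). [cite: Salmhofer1999, §4.2.5 (4.70)] -/
def normSqDiv (Λ : ℝ) (x : FreqBand) : ℝ := ‖x‖ ^ 2 / Λ ^ 2

/-- `Q` is smooth. [cite: Salmhofer1999, §4.2.5 (4.70)] -/
theorem contDiff_normSqDiv (Λ : ℝ) {n : WithTop ℕ∞} : ContDiff ℝ n (normSqDiv Λ) :=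
  (contDiff_norm_sq ℝ).div_const _

/-- `DQ = (2/Λ²)·⟨x, ·⟩`. [cite: Salmhofer1999, §4.2.5 (4.70)] -/
theorem fderiv_normSqDiv (Λ : ℝ) : fderiv ℝ (normSqDiv Λ) = fun x => (2 / Λ ^ 2) • innerSL ℝ x := by
  funext x
  have h : normSqDiv Λ = (Λ ^ 2)⁻¹ • fun x : FreqBand => ‖x‖ ^ 2 := by
    funext y; simp only [normSqDiv, Pi.smul_apply, smul_eq_mul]; ring
  rw [h, fderiv_const_smul ((contDiff_norm_sq ℝ (n := 1)).differentiable one_ne_zero x), fderiv_norm_sq]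
  ext v
  simp only [Pi.smul_apply, smul_apply, smul_eq_mul, nsmul_eq_mul, Nat.cast_ofNat, innerSL_apply_apply]
  ring

/-- `D²Q = (2/Λ²)·⟨·, ·⟩` (a constant bilinear map). [cite: Salmhofer1999, §4.2.5 (4.70)] -/
theorem fderiv_fderiv_normSqDiv (Λ : ℝ) (x : FreqBand) :
    fderiv ℝ (fderiv ℝ (normSqDiv Λ)) x = (2 / Λ ^ 2) • (innerSL ℝ : FreqBand →L[ℝ] FreqBand →L[ℝ] ℝ) := by
  rw [fderiv_normSqDiv, show (fun x : FreqBand => (2 / Λ ^ 2) • innerSL ℝ x) =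
    fun x => ((2 / Λ ^ 2) • (innerSL ℝ : FreqBand →L[ℝ] FreqBand →L[ℝ] ℝ)) x from rfl, ContinuousLinearMap.fderiv]

/-- `D³Q = 0`. [cite: Salmhofer1999, §4.2.5 (4.70)] -/
theorem fderiv_fderiv_fderiv_normSqDiv (Λ : ℝ) : fderiv ℝ (fderiv ℝ (fderiv ℝ (normSqDiv Λ))) = 0 := by
  rw [show fderiv ℝ (fderiv ℝ (normSqDiv Λ)) = fun _ => (2 / Λ ^ 2) • (innerSL ℝ : FreqBand →L[ℝ] FreqBand →L[ℝ] ℝ) from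
    funext (fderiv_fderiv_normSqDiv Λ)]
  exact fderiv_const _

/-- `‖D¹Q x‖ ≤ 2‖x‖/Λ²`. [cite: Salmhofer1999, §4.2.5 (4.70)] -/
theorem norm_iteratedFDeriv_one_normSqDiv_le {Λ : ℝ} (hΛ : 0 < Λ) (x : FreqBand) :
    ‖iteratedFDeriv ℝ 1 (normSqDiv Λ) x‖ ≤ 2 * ‖x‖ / Λ ^ 2 := by
  rw [← norm_iteratedFDeriv_fderiv, norm_iteratedFDeriv_zero, fderiv_normSqDiv]
  dsimp only
  rw [norm_smul, innerSL_apply_norm, Real.norm_eq_abs, abs_of_pos (by positivity)]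
  exact le_of_eq (by ring)

/-- `‖D²Q x‖ ≤ 2/Λ²`. [cite: Salmhofer1999, §4.2.5 (4.70)] -/
theorem norm_iteratedFDeriv_two_normSqDiv_le {Λ : ℝ} (hΛ : 0 < Λ) (x : FreqBand) :
    ‖iteratedFDeriv ℝ 2 (normSqDiv Λ) x‖ ≤ 2 / Λ ^ 2 := by
  rw [← norm_iteratedFDeriv_fderiv, ← norm_iteratedFDeriv_fderiv, norm_iteratedFDeriv_zero, fderiv_fderiv_normSqDiv, norm_smul,
    Real.norm_eq_abs, abs_of_pos (by positivity)]
  have h : ‖(innerSL ℝ : FreqBand →L[ℝ] FreqBand →L[ℝ] ℝ)‖ ≤ 1 :=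
    ContinuousLinearMap.opNorm_le_bound _ zero_le_one fun v => by rw [innerSL_apply_norm, one_mul]
  calc 2 / Λ ^ 2 * ‖(innerSL ℝ : FreqBand →L[ℝ] FreqBand →L[ℝ] ℝ)‖ ≤ 2 / Λ ^ 2 * 1 := mul_le_mul_of_nonneg_left h (by positivity)
    _ = 2 / Λ ^ 2 := mul_one _

/-- `DⁱQ = 0` for `i ≥ 3`. [cite: Salmhofer1999, §4.2.5 (4.70)] -/
theorem iteratedFDeriv_normSqDiv_eq_zero (Λ : ℝ) {i : ℕ} (hi : 3 ≤ i) (x : FreqBand) : iteratedFDeriv ℝ i (normSqDiv Λ) x = 0 := by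
  obtain ⟨j, rfl⟩ : ∃ j, i = j + 3 := ⟨i - 3, by omega⟩
  have h : ‖iteratedFDeriv ℝ (j + 1 + 1 + 1) (normSqDiv Λ) x‖ = 0 := by
    rw [← norm_iteratedFDeriv_fderiv, ← norm_iteratedFDeriv_fderiv, ← norm_iteratedFDeriv_fderiv,
      fderiv_fderiv_fderiv_normSqDiv, iteratedFDeriv_zero, Pi.zero_apply, norm_zero]
  exact norm_eq_zero.1 h

/-- **On the ball `‖x‖ ≤ Λ`: `‖DⁱQ x‖ ≤ (2/Λ)ⁱ` for `1 ≤ i`** (`0 < Λ`). [cite: Salmhofer1999, §4.2.5 (4.70)] -/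
theorem norm_iteratedFDeriv_normSqDiv_le {Λ : ℝ} (hΛ : 0 < Λ) {x : FreqBand} (hx : ‖x‖ ≤ Λ) {i : ℕ} (hi : 1 ≤ i) :
    ‖iteratedFDeriv ℝ i (normSqDiv Λ) x‖ ≤ (2 / Λ) ^ i := by
  rcases Nat.lt_or_ge i 3 with h | h
  · interval_cases i
    · calc ‖iteratedFDeriv ℝ 1 (normSqDiv Λ) x‖ ≤ 2 * ‖x‖ / Λ ^ 2 := norm_iteratedFDeriv_one_normSqDiv_le hΛ x
        _ ≤ 2 * Λ / Λ ^ 2 := by gcongr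
        _ = (2 / Λ) ^ 1 := by field_simp
    · calc ‖iteratedFDeriv ℝ 2 (normSqDiv Λ) x‖ ≤ 2 / Λ ^ 2 := norm_iteratedFDeriv_two_normSqDiv_le hΛ x
        _ ≤ (2 / Λ) ^ 2 := by rw [div_pow]; gcongr; norm_num
  · rw [iteratedFDeriv_normSqDiv_eq_zero Λ h x, norm_zero]
    positivity

/-! ### §3 The weight `W = χ₂ ∘ Q` on the plane -/

/-- The ultraviolet weight on the plane: `W(x) = χ₂(‖x‖²/Λ²)` (`= uvWeightFn Λ x₁ x₀`). [cite: Salmhofer1999, §4.2.5 (4.70)] -/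
def uvWeight₂ (Λ : ℝ) (x : FreqBand) : ℝ := salmhoferCutoff (normSqDiv Λ x)

/-- `W(x) = uvWeightFn Λ (x 1) (x 0)`. [cite: Salmhofer1999, §4.2.5 (4.70)] -/
theorem uvWeight₂_apply (Λ : ℝ) (x : FreqBand) : uvWeight₂ Λ x = uvWeightFn Λ (x 1) (x 0) := by
  rw [uvWeight₂, uvWeightFn, normSqDiv, norm_sq_freqBand]

/-- `W` is smooth. [cite: Salmhofer1999, §4.2.5 (4.70)] -/
theorem contDiff_uvWeight₂ (Λ : ℝ) {n : ℕ∞} : ContDiff ℝ n (uvWeight₂ Λ) :=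
  (contDiff_salmhoferCutoff (n := n)).comp (contDiff_normSqDiv Λ)

/-- **`W`'s derivatives on the ball `‖x‖ ≤ Λ`**: if `|χ₂^{(i)}| ≤ B` for `i ≤ n` then `‖DⁿW(x)‖ ≤ n!·B·(2/Λ)ⁿ`.
[cite: Salmhofer1999, §4.2.5 (4.70)] -/
theorem norm_iteratedFDeriv_uvWeight₂_le_shell {Λ : ℝ} (hΛ : 0 < Λ) {n : ℕ} {B : ℝ}
    (hB : ∀ i ≤ n, ∀ t, ‖iteratedDeriv i salmhoferCutoff t‖ ≤ B) {x : FreqBand} (hx : ‖x‖ ≤ Λ) :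
    ‖iteratedFDeriv ℝ n (uvWeight₂ Λ) x‖ ≤ n ! * B * (2 / Λ) ^ n := by
  have h : uvWeight₂ Λ = salmhoferCutoff ∘ normSqDiv Λ := rfl
  rw [h]
  refine norm_iteratedFDeriv_comp_le (N := (n : ℕ∞)) (contDiff_salmhoferCutoff (n := n)) (contDiff_normSqDiv Λ) le_rfl x
    (fun i hi => ?_) (fun i hi1 hin => ?_)
  · rw [norm_iteratedFDeriv_eq_norm_iteratedDeriv]
    exact hB i hi _
  · exact norm_iteratedFDeriv_normSqDiv_le hΛ hx hi1

/-- Inside the ball `‖x‖ < Λ/2` the weight vanishes identically near `x`, so do all its derivatives (and its value).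
[cite: Salmhofer1999, §4.2.5 (4.70)] -/
theorem iteratedFDeriv_uvWeight₂_eq_zero_of_lt {Λ : ℝ} (hΛ : 0 < Λ) {x : FreqBand} (hx : ‖x‖ < Λ / 2) (n : ℕ) :
    iteratedFDeriv ℝ n (uvWeight₂ Λ) x = 0 := by
  have hev : uvWeight₂ Λ =ᶠ[𝓝 x] fun _ => (0 : ℝ) := by
    have hopen : IsOpen {y : FreqBand | ‖y‖ < Λ / 2} := isOpen_lt continuous_norm continuous_const
    filter_upwards [hopen.mem_nhds hx] with y hy
    refine salmhoferCutoff_of_le ?_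
    rw [normSqDiv, div_le_iff₀ (by positivity)]
    have hy' : ‖y‖ < Λ / 2 := hy
    nlinarith [norm_nonneg y]
  rw [(hev.iteratedFDeriv ℝ n).eq_of_nhds, iteratedFDeriv_fun_zero]
  rfl

/-- Outside the ball `‖x‖ > Λ` the weight is identically `1` near `x`, so its derivatives of positive order vanish.
[cite: Salmhofer1999, §4.2.5 (4.70)] -/
theorem iteratedFDeriv_uvWeight₂_eq_zero_of_gt {Λ : ℝ} (hΛ : 0 < Λ) {x : FreqBand} (hx : Λ < ‖x‖) {n : ℕ} (hn : 1 ≤ n) :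
    iteratedFDeriv ℝ n (uvWeight₂ Λ) x = 0 := by
  have hev : uvWeight₂ Λ =ᶠ[𝓝 x] fun _ => (1 : ℝ) := by
    have hopen : IsOpen {y : FreqBand | Λ < ‖y‖} := isOpen_lt continuous_const continuous_norm
    filter_upwards [hopen.mem_nhds hx] with y hy
    refine salmhoferCutoff_of_ge ?_
    rw [normSqDiv, le_div_iff₀ (by positivity)]
    have hy' : Λ < ‖y‖ := hy
    nlinarith [norm_nonneg y, hΛ]
  rw [(hev.iteratedFDeriv ℝ n).eq_of_nhds, iteratedFDeriv_const_of_ne (by omega)]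
  rfl

/-- `W(x) = 1` outside the ball `‖x‖ > Λ`. [cite: Salmhofer1999, §4.2.5 (4.70)] -/
theorem uvWeight₂_eq_one_of_gt {Λ : ℝ} (hΛ : 0 < Λ) {x : FreqBand} (hx : Λ < ‖x‖) : uvWeight₂ Λ x = 1 := by
  refine salmhoferCutoff_of_ge ?_
  rw [normSqDiv, le_div_iff₀ (by positivity)]
  nlinarith [norm_nonneg x, hΛ]

/-- `|W| ≤ 1`. [cite: Salmhofer1999, §4.2.5 (4.70)] -/
theorem norm_uvWeight₂_le_one (Λ : ℝ) (x : FreqBand) : ‖uvWeight₂ Λ x‖ ≤ 1 := by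
  rw [uvWeight₂, Real.norm_eq_abs, abs_of_nonneg (salmhoferCutoff_mem_Icc _).1]
  exact (salmhoferCutoff_mem_Icc _).2

/-! ### §4 The resolvent factor `R = c·(A ·)⁻¹` and its derivatives (complex-analytic inverse read over `ℝ`) -/

/-- The resolvent factor on the plane: `R(x) = c·(A x)⁻¹ = c/(-i x₀ + x₁)`. [cite: Salmhofer1999, §4.2.5 (4.70)] -/
def uvRes₂ (c : ℝ) (x : FreqBand) : ℂ := (c : ℂ) * (uvLin x)⁻¹

/-- `R(x) = resolventFn c 0 (x 1) (x 0)`. [cite: Salmhofer1999, §4.2.5 (4.70)] -/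
theorem uvRes₂_apply (c : ℝ) (x : FreqBand) : uvRes₂ c x = resolventFn c 0 (x 1) (x 0) := by
  rw [uvRes₂, resolventFn, uvLin_apply, add_zero, div_eq_mul_inv]

/-- **The `ℝ`-iterated derivatives of the complex inverse**: `‖Dᵏ(z ↦ z⁻¹)(z)‖ = k!/‖z‖^{k+1}` for `z ≠ 0` (the complex `k`-th derivative
`(-1)ᵏ k! z^{-k-1}` read over `ℝ`). [cite: BenfattoGiulianiMastropietro2006, §2.1 (2.3)] -/
theorem norm_iteratedFDeriv_real_inv {z : ℂ} (hz : z ≠ 0) (k : ℕ) :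
    ‖iteratedFDeriv ℝ k (fun w : ℂ => w⁻¹) z‖ = k ! / ‖z‖ ^ (k + 1) := by
  have hC : ContDiffAt ℂ k (fun w : ℂ => w⁻¹) z := contDiffAt_inv ℂ hz
  rw [← hC.restrictScalars_iteratedFDeriv (𝕜 := ℝ), Function.comp_apply, ContinuousMultilinearMap.norm_restrictScalars,
    norm_iteratedFDeriv_eq_norm_iteratedDeriv, iteratedDeriv_eq_iterate, iter_deriv_inv, norm_mul, norm_mul, norm_pow, norm_neg,
    norm_one, one_pow, one_mul, Complex.norm_natCast, norm_zpow, show (-1 - (k : ℤ)) = -((k + 1 : ℕ) : ℤ) by push_cast; ring,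
    zpow_neg, zpow_natCast, div_eq_mul_inv]

/-- `R` is smooth away from the origin. [cite: Salmhofer1999, §4.2.5 (4.70)] -/
theorem contDiffAt_uvRes₂ (c : ℝ) {x : FreqBand} (hx : x ≠ 0) {n : WithTop ℕ∞} : ContDiffAt ℝ n (uvRes₂ c) x := by
  have hAx : uvLin x ≠ 0 := by
    intro h; apply hx
    have h1 : ‖uvLin x‖ = 0 := by rw [h, norm_zero]
    rw [norm_uvLin_apply] at h1
    exact norm_eq_zero.1 h1
  exact contDiffAt_const.mul ((contDiffAt_inv ℝ hAx).comp x uvLin.contDiff.contDiffAt)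

/-- `R` is smooth on the punctured plane. [cite: Salmhofer1999, §4.2.5 (4.70)] -/
theorem contDiffOn_uvRes₂ (c : ℝ) {n : WithTop ℕ∞} : ContDiffOn ℝ n (uvRes₂ c) {x | x ≠ 0} :=
  fun _ hx => (contDiffAt_uvRes₂ c hx).contDiffWithinAt

/-- **`R`'s derivatives away from the origin**: `‖DᵏR(x)‖ ≤ c·k!/‖x‖^{k+1}` (`c ≥ 0`, `x ≠ 0`).
[cite: BenfattoGiulianiMastropietro2006, §2.1 (2.3)] -/
theorem norm_iteratedFDeriv_uvRes₂_le {c : ℝ} (hc : 0 ≤ c) {x : FreqBand} (hx : x ≠ 0) (k : ℕ) :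
    ‖iteratedFDeriv ℝ k (uvRes₂ c) x‖ ≤ c * (k ! / ‖x‖ ^ (k + 1)) := by
  have hAx : uvLin x ≠ 0 := by
    intro h; apply hx
    have h1 : ‖uvLin x‖ = 0 := by rw [h, norm_zero]
    rw [norm_uvLin_apply] at h1
    exact norm_eq_zero.1 h1
  -- `Inv ∘ A` within the open sets `{z ≠ 0}` / `{x ≠ 0}`
  set s : Set ℂ := {z | z ≠ 0} with hs
  have hsopen : IsOpen s := isOpen_ne
  have hpre : uvLin ⁻¹' s = {y : FreqBand | y ≠ 0} := by
    ext y
    simp only [hs, Set.mem_preimage, Set.mem_setOf_eq, ne_eq]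
    constructor
    · intro h hy; exact h (by rw [hy, map_zero])
    · intro h hA; apply h
      have h1 : ‖uvLin y‖ = 0 := by rw [hA, norm_zero]
      rw [norm_uvLin_apply] at h1
      exact norm_eq_zero.1 h1
  have hpreopen : IsOpen (uvLin ⁻¹' s) := hsopen.preimage uvLin.continuous
  have hinv : ContDiffOn ℝ k (fun w : ℂ => w⁻¹) s := fun z hz => (contDiffAt_inv ℝ hz).contDiffWithinAt
  have hcomp := uvLin.iteratedFDerivWithin_comp_right (f := fun w : ℂ => w⁻¹) hinv hsopen.uniqueDiffOn hpreopen.uniqueDiffOn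
    (x := x) hAx (i := k) le_rfl
  rw [iteratedFDerivWithin_of_isOpen k hpreopen (by rw [hpre]; exact hx), iteratedFDerivWithin_of_isOpen k hsopen hAx] at hcomp
  have hnormIA : ‖iteratedFDeriv ℝ k ((fun w : ℂ => w⁻¹) ∘ uvLin) x‖ ≤ k ! / ‖x‖ ^ (k + 1) := by
    rw [hcomp]
    refine (ContinuousMultilinearMap.norm_compContinuousLinearMap_le _ _).trans ?_
    rw [norm_iteratedFDeriv_real_inv hAx, norm_uvLin_apply, Finset.prod_const, Finset.card_univ, Fintype.card_fin]
    exact mul_le_of_le_one_right (by positivity) (pow_le_one₀ (norm_nonneg _) norm_uvLin_le_one)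
  -- the constant factor `c`
  have hfun : uvRes₂ c = fun y => (c : ℂ) • ((fun w : ℂ => w⁻¹) ∘ uvLin) y := by
    funext y; simp [uvRes₂, smul_eq_mul]
  have hcd : ContDiffAt ℝ k ((fun w : ℂ => w⁻¹) ∘ uvLin) x := (contDiffAt_inv ℝ hAx).comp x uvLin.contDiff.contDiffAt
  rw [hfun, iteratedFDeriv_const_smul_apply' hcd, norm_smul, Complex.norm_real, Real.norm_eq_abs, abs_of_nonneg hc]
  exact mul_le_mul_of_nonneg_left hnormIA hc

/-! ### §5 The symbol `Ψ = W·R` on the plane and the bound on all its derivatives -/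

/-- **The ultraviolet symbol on the frequency–band plane**: `Ψ(x) = W(x)·R(x) = χ₂(‖x‖²/Λ²)·c/(-i x₀ + x₁)`.
[cite: Salmhofer1999, §4.2.5 (4.70)] -/
def uvSymbol₂ (c Λ : ℝ) (x : FreqBand) : ℂ := ((uvWeight₂ Λ x : ℝ) : ℂ) * uvRes₂ c x

/-- `Ψ(x) = uvSymbolFn c Λ (x 1) (x 0)` (the symbol of `HubbardUVSymbolSmooth`, band `e = x 1`, frequency `ω = x 0`).
[cite: Salmhofer1999, §4.2.5 (4.70)] -/
theorem uvSymbol₂_apply_eq_uvSymbolFn (c Λ : ℝ) (x : FreqBand) : uvSymbol₂ c Λ x = uvSymbolFn c Λ (x 1) (x 0) := by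
  rw [uvSymbol₂, uvSymbolFn, uvWeight₂_apply, uvRes₂_apply]

/-- Near a point of the open ball `‖x‖ < Λ/2` the symbol vanishes identically. [cite: Salmhofer1999, §4.2.5 (4.70)] -/
theorem uvSymbol₂_eventuallyEq_zero (c : ℝ) {Λ : ℝ} (hΛ : 0 < Λ) {x : FreqBand} (hx : ‖x‖ < Λ / 2) :
    uvSymbol₂ c Λ =ᶠ[𝓝 x] fun _ => (0 : ℂ) := by
  have hopen : IsOpen {y : FreqBand | ‖y‖ < Λ / 2} := isOpen_lt continuous_norm continuous_const
  filter_upwards [hopen.mem_nhds hx] with y hy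
  have hy' : ‖y‖ < Λ / 2 := hy
  have hW : uvWeight₂ Λ y = 0 := by
    refine salmhoferCutoff_of_le ?_
    rw [normSqDiv, div_le_iff₀ (by positivity)]
    nlinarith [norm_nonneg y]
  rw [uvSymbol₂, hW, Complex.ofReal_zero, zero_mul]

/-- `Ψ` is smooth at every point (near the origin it vanishes; elsewhere both factors are smooth). [cite: Salmhofer1999, §4.2.5 (4.70)] -/
theorem contDiffAt_uvSymbol₂ (c : ℝ) {Λ : ℝ} (hΛ : 0 < Λ) {n : ℕ∞} (x : FreqBand) : ContDiffAt ℝ n (uvSymbol₂ c Λ) x := by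
  by_cases hx : x = 0
  · have h0 : ‖x‖ < Λ / 2 := by rw [hx, norm_zero]; positivity
    exact (contDiffAt_const (c := (0 : ℂ))).congr_of_eventuallyEq (uvSymbol₂_eventuallyEq_zero c hΛ h0)
  · exact ((Complex.ofRealCLM.contDiff.comp (contDiff_uvWeight₂ Λ (n := n))).contDiffAt).mul (contDiffAt_uvRes₂ c hx)

/-- `Ψ` is smooth. [cite: Salmhofer1999, §4.2.5 (4.70)] -/
theorem contDiff_uvSymbol₂ (c : ℝ) {Λ : ℝ} (hΛ : 0 < Λ) {n : ℕ∞} : ContDiff ℝ n (uvSymbol₂ c Λ) :=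
  contDiff_iff_contDiffAt.2 fun x => contDiffAt_uvSymbol₂ c hΛ x

/-- Inside the ball `‖x‖ < Λ/2` all derivatives of `Ψ` vanish. [cite: Salmhofer1999, §4.2.5 (4.70)] -/
theorem iteratedFDeriv_uvSymbol₂_eq_zero_of_lt (c : ℝ) {Λ : ℝ} (hΛ : 0 < Λ) {x : FreqBand} (hx : ‖x‖ < Λ / 2) (n : ℕ) :
    iteratedFDeriv ℝ n (uvSymbol₂ c Λ) x = 0 := by
  rw [((uvSymbol₂_eventuallyEq_zero c hΛ hx).iteratedFDeriv ℝ n).eq_of_nhds, iteratedFDeriv_fun_zero]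
  rfl

/-- The derivatives of the (complexified) weight have the norms of those of the weight. [cite: Salmhofer1999, §4.2.5 (4.70)] -/
theorem norm_iteratedFDeriv_ofReal_uvWeight₂ (Λ : ℝ) (i : ℕ) (x : FreqBand) :
    ‖iteratedFDeriv ℝ i (fun y => ((uvWeight₂ Λ y : ℝ) : ℂ)) x‖ = ‖iteratedFDeriv ℝ i (uvWeight₂ Λ) x‖ := by
  have h : (fun y => ((uvWeight₂ Λ y : ℝ) : ℂ)) = Complex.ofRealLI ∘ uvWeight₂ Λ := rfl
  rw [h, Complex.ofRealLI.norm_iteratedFDeriv_comp_left ((contDiff_uvWeight₂ Λ (n := i)).contDiffAt) le_rfl]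

/-- **All derivatives of the ultraviolet symbol at once**: if `1 ≤ B` bounds `|χ₂^{(i)}|` for `i ≤ N`, then for `n ≤ N` and EVERY `x`,
`‖Dⁿ Ψ(x)‖ ≤ c·B·(n+1)!·(2/m)^{n+1}` with `m = max(|x₀|, Λ/2)` (`c ≥ 0`, `Λ > 0`) — every mixed partial `∂_ω^a ∂_e^b Ψ`, `a + b = n`, is bounded
by the right side.  (Inside: `Ψ ≡ 0`; on the transition shell `Λ/2 ≤ ‖x‖ ≤ Λ`: Leibniz with `‖DⁱW‖ ≤ i!B(2/Λ)ⁱ`, `‖DᵏR‖ ≤ c k!(2/Λ)^{k+1}`; outside: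
`W ≡ 1` and `‖DⁿR‖ ≤ c n!/‖x‖^{n+1}`.) [cite: BenfattoGiulianiMastropietro2006, §2.1 (2.3) and (2.36aa)] -/
theorem norm_iteratedFDeriv_uvSymbol₂_le {c Λ : ℝ} (hc : 0 ≤ c) (hΛ : 0 < Λ) {N : ℕ} {B : ℝ} (hB1 : 1 ≤ B)
    (hB : ∀ i ≤ N, ∀ t, ‖iteratedDeriv i salmhoferCutoff t‖ ≤ B) {n : ℕ} (hn : n ≤ N) (x : FreqBand) :
    ‖iteratedFDeriv ℝ n (uvSymbol₂ c Λ) x‖ ≤ c * B * (n + 1) ! * (2 / max |x 0| (Λ / 2)) ^ (n + 1) := by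
  set m : ℝ := max |x 0| (Λ / 2) with hm
  have hm0 : 0 < m := lt_max_of_lt_right (by positivity)
  have hB0 : 0 ≤ B := zero_le_one.trans hB1
  have hRHS0 : 0 ≤ c * B * (n + 1) ! * (2 / m) ^ (n + 1) := by positivity
  by_cases hin : ‖x‖ < Λ / 2
  · rw [iteratedFDeriv_uvSymbol₂_eq_zero_of_lt c hΛ hin n, norm_zero]; exact hRHS0
  push Not at hin
  -- `x ≠ 0`, `‖x‖ ≥ m`
  have hx0 : x ≠ 0 := by intro h; rw [h, norm_zero] at hin; linarith
  have hxm : m ≤ ‖x‖ := max_le (abs_apply_zero_le_norm x) hin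
  have hxpos : 0 < ‖x‖ := hm0.trans_le hxm
  -- Leibniz within the punctured plane (open), read back as global derivatives
  set U : Set FreqBand := {y | y ≠ 0} with hU
  have hUopen : IsOpen U := isOpen_ne
  have hxU : x ∈ U := hx0
  have hWc : ContDiffOn ℝ n (fun y => ((uvWeight₂ Λ y : ℝ) : ℂ)) U :=
    (Complex.ofRealCLM.contDiff.comp (contDiff_uvWeight₂ Λ (n := n))).contDiffOn
  have hRc : ContDiffOn ℝ n (uvRes₂ c) U := contDiffOn_uvRes₂ c
  have hL := norm_iteratedFDerivWithin_mul_le hWc hRc hUopen.uniqueDiffOn hxU (n := n) le_rfl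
  rw [iteratedFDerivWithin_of_isOpen n hUopen hxU] at hL
  have hL' : ‖iteratedFDeriv ℝ n (uvSymbol₂ c Λ) x‖ ≤ ∑ i ∈ Finset.range (n + 1), (n.choose i : ℝ) *
      ‖iteratedFDeriv ℝ i (fun y => ((uvWeight₂ Λ y : ℝ) : ℂ)) x‖ * ‖iteratedFDeriv ℝ (n - i) (uvRes₂ c) x‖ := by
    refine (le_of_eq ?_).trans (hL.trans (le_of_eq (Finset.sum_congr rfl fun i hi => ?_)))
    · rfl
    · rw [iteratedFDerivWithin_of_isOpen i hUopen hxU, iteratedFDerivWithin_of_isOpen (n - i) hUopen hxU]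
  -- every Leibniz term is at most `n!·B·c·(2/m)^{n+1}`
  have hterm : ∀ i ∈ Finset.range (n + 1), (n.choose i : ℝ) * ‖iteratedFDeriv ℝ i (fun y => ((uvWeight₂ Λ y : ℝ) : ℂ)) x‖ *
      ‖iteratedFDeriv ℝ (n - i) (uvRes₂ c) x‖ ≤ n ! * B * c * (2 / m) ^ (n + 1) := by
    intro i hi
    have hin' : i ≤ n := Nat.lt_succ_iff.1 (Finset.mem_range.1 hi)
    rw [norm_iteratedFDeriv_ofReal_uvWeight₂]
    have hR := norm_iteratedFDeriv_uvRes₂_le hc hx0 (n - i)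
    by_cases hshell : ‖x‖ ≤ Λ
    · -- on the shell: `m ≤ Λ`, `‖DⁱW‖ ≤ i!B(2/Λ)ⁱ ≤ i!B(2/m)ⁱ`, `‖DᵏR‖ ≤ c k!/‖x‖^{k+1} ≤ c k! (2/m)^{k+1}`… wait `1/‖x‖ ≤ 1/m ≤ 2/m`
      have hmΛ : m ≤ Λ := max_le ((abs_apply_zero_le_norm x).trans hshell) (by linarith)
      have hW := norm_iteratedFDeriv_uvWeight₂_le_shell hΛ (fun j hj t => hB j (hj.trans (hin'.trans hn)) t) hshell (n := i)
      have h2Λ : 2 / Λ ≤ 2 / m := div_le_div_of_nonneg_left (by norm_num) hm0 hmΛ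
      have h1x : 1 / ‖x‖ ≤ 2 / m := by
        rw [div_le_div_iff₀ hxpos hm0]; nlinarith
      calc (n.choose i : ℝ) * ‖iteratedFDeriv ℝ i (uvWeight₂ Λ) x‖ * ‖iteratedFDeriv ℝ (n - i) (uvRes₂ c) x‖
          ≤ (n.choose i : ℝ) * (i ! * B * (2 / Λ) ^ i) * (c * ((n - i) ! / ‖x‖ ^ (n - i + 1))) :=
            mul_le_mul (mul_le_mul_of_nonneg_left hW (Nat.cast_nonneg _)) hR (norm_nonneg _) (by positivity)
        _ = (n.choose i * i ! * (n - i) ! : ℕ) * B * c * ((2 / Λ) ^ i * (1 / ‖x‖) ^ (n - i + 1)) := by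
            push_cast
            rw [one_div, inv_pow]
            ring
        _ = (n ! : ℕ) * B * c * ((2 / Λ) ^ i * (1 / ‖x‖) ^ (n - i + 1)) := by rw [Nat.choose_mul_factorial_mul_factorial hin']
        _ ≤ (n ! : ℕ) * B * c * ((2 / m) ^ i * (2 / m) ^ (n - i + 1)) := by
            refine mul_le_mul_of_nonneg_left ?_ (by positivity)
            exact mul_le_mul (pow_le_pow_left₀ (by positivity) h2Λ i) (pow_le_pow_left₀ (by positivity) h1x _)
              (by positivity) (by positivity)
        _ = n ! * B * c * (2 / m) ^ (n + 1) := by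
            rw [← pow_add, show i + (n - i + 1) = n + 1 by omega]
    · -- outside: the weight's positive-order derivatives vanish, its value is `≤ 1`
      push Not at hshell
      rcases Nat.eq_zero_or_pos i with rfl | hi0
      · rw [norm_iteratedFDeriv_zero, Nat.choose_zero_right, Nat.cast_one, one_mul, Nat.sub_zero]
        have h1x : 1 / ‖x‖ ≤ 2 / m := by
          rw [div_le_div_iff₀ hxpos hm0]; nlinarith
        calc ‖uvWeight₂ Λ x‖ * ‖iteratedFDeriv ℝ n (uvRes₂ c) x‖ ≤ 1 * (c * (n ! / ‖x‖ ^ (n + 1))) :=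
              mul_le_mul (norm_uvWeight₂_le_one Λ x) hR (norm_nonneg _) zero_le_one
          _ = n ! * 1 * c * (1 / ‖x‖) ^ (n + 1) := by rw [one_div, inv_pow]; ring
          _ ≤ n ! * B * c * (2 / m) ^ (n + 1) := by
              gcongr
      · rw [iteratedFDeriv_uvWeight₂_eq_zero_of_gt hΛ hshell hi0, norm_zero, mul_zero, zero_mul]
        positivity
  calc ‖iteratedFDeriv ℝ n (uvSymbol₂ c Λ) x‖
      ≤ ∑ i ∈ Finset.range (n + 1), (n.choose i : ℝ) * ‖iteratedFDeriv ℝ i (fun y => ((uvWeight₂ Λ y : ℝ) : ℂ)) x‖ *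
          ‖iteratedFDeriv ℝ (n - i) (uvRes₂ c) x‖ := hL'
    _ ≤ ∑ _i ∈ Finset.range (n + 1), (n ! : ℝ) * B * c * (2 / m) ^ (n + 1) := Finset.sum_le_sum hterm
    _ = c * B * (n + 1) ! * (2 / m) ^ (n + 1) := by
        rw [Finset.sum_const, Finset.card_range, nsmul_eq_mul, Nat.factorial_succ]
        push_cast
        ring

/-! ### §6 Frequency shifts: `DⁱΨ` is Lipschitz along same-sign frequency segments -/

/-- If `0 ≤ ab` then every convex combination of `a`, `b` has modulus at least `min(|a|, |b|)`. [cite: BenfattoGiulianiMastropietro2006, (2.36aa)] -/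
theorem min_abs_le_abs_convexComb {a b t : ℝ} (h : 0 ≤ a * b) (ht0 : 0 ≤ t) (ht1 : t ≤ 1) :
    min |a| |b| ≤ |(1 - t) * a + t * b| := by
  rcases le_or_gt 0 a with ha | ha
  · rcases eq_or_lt_of_le ha with hz | ha'
    · rw [← hz, abs_zero]
      exact min_le_of_left_le (abs_nonneg _)
    · have hb : 0 ≤ b := by nlinarith
      rw [abs_of_nonneg ha, abs_of_nonneg hb, abs_of_nonneg (by nlinarith)]
      rcases le_total a b with hab | hab
      · rw [min_eq_left hab]; nlinarith
      · rw [min_eq_right hab]; nlinarith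
  · have hb : b ≤ 0 := by nlinarith
    rw [abs_of_neg ha, abs_of_nonpos hb, abs_of_nonpos (by nlinarith)]
    rcases le_total a b with hab | hab
    · rw [min_eq_right (by linarith)]; nlinarith
    · rw [min_eq_left (by linarith)]; nlinarith

/-- Along a segment whose endpoints have frequencies of the same sign, `|y₀| ≥ min(|x₀|, |x'₀|)`. [cite: BenfattoGiulianiMastropietro2006, (2.36aa)] -/
theorem min_abs_le_abs_lineMap_zero {x x' : FreqBand} (hsign : 0 ≤ x 0 * x' 0) {t : ℝ} (ht0 : 0 ≤ t) (ht1 : t ≤ 1) :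
    min |x 0| |x' 0| ≤ |(AffineMap.lineMap x x' t : FreqBand) 0| := by
  rw [AffineMap.lineMap_apply_module]
  simp only [PiLp.add_apply, PiLp.smul_apply, smul_eq_mul]
  exact min_abs_le_abs_convexComb hsign ht0 ht1

/-- **The derivatives of `Ψ` are Lipschitz along same-sign frequency segments, with the envelope of the next order**:
if `0 ≤ x₀·x'₀` then `‖DⁱΨ(x') − DⁱΨ(x)‖ ≤ c·B·(i+2)!·(2/m₀)^{i+2}·‖x' − x‖`, `m₀ = max(min(|x₀|,|x'₀|), Λ/2)` (`i + 1 ≤ N`) — one time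
difference of a band-differentiated symbol costs the frequency step times the next envelope. [cite: BenfattoGiulianiMastropietro2006, §2.1 (2.3) and (2.36aa)] -/
theorem norm_iteratedFDeriv_uvSymbol₂_sub_le {c Λ : ℝ} (hc : 0 ≤ c) (hΛ : 0 < Λ) {N : ℕ} {B : ℝ} (hB1 : 1 ≤ B)
    (hB : ∀ i ≤ N, ∀ t, ‖iteratedDeriv i salmhoferCutoff t‖ ≤ B) {i : ℕ} (hi : i + 1 ≤ N) {x x' : FreqBand}
    (hsign : 0 ≤ x 0 * x' 0) :
    ‖iteratedFDeriv ℝ i (uvSymbol₂ c Λ) x' - iteratedFDeriv ℝ i (uvSymbol₂ c Λ) x‖ ≤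
      c * B * (i + 2) ! * (2 / max (min |x 0| |x' 0|) (Λ / 2)) ^ (i + 2) * ‖x' - x‖ := by
  set m₀ : ℝ := max (min |x 0| |x' 0|) (Λ / 2) with hm₀
  have hm₀pos : 0 < m₀ := lt_max_of_lt_right (by positivity)
  have hB0 : 0 ≤ B := zero_le_one.trans hB1
  set K : ℝ := c * B * (i + 2) ! * (2 / m₀) ^ (i + 2) with hK
  -- the derivative of `DⁱΨ` is `D^{i+1}Ψ`, bounded by `K` on the segment
  have hdiff : Differentiable ℝ (iteratedFDeriv ℝ i (uvSymbol₂ c Λ)) :=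
    (contDiff_uvSymbol₂ c hΛ (n := (i + 1 : ℕ))).differentiable_iteratedFDeriv (by exact_mod_cast Nat.lt_succ_self i)
  have hseg : ∀ y ∈ segment ℝ x x', ‖fderiv ℝ (iteratedFDeriv ℝ i (uvSymbol₂ c Λ)) y‖ ≤ K := by
    intro y hy
    rw [norm_fderiv_iteratedFDeriv]
    rw [segment_eq_image_lineMap] at hy
    obtain ⟨t, ⟨ht0, ht1⟩, rfl⟩ := hy
    have hmin := min_abs_le_abs_lineMap_zero hsign ht0 ht1
    have hmy : m₀ ≤ max |(AffineMap.lineMap x x' t : FreqBand) 0| (Λ / 2) := max_le_max hmin le_rfl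
    have h := norm_iteratedFDeriv_uvSymbol₂_le hc hΛ hB1 hB (n := i + 1) hi (AffineMap.lineMap x x' t)
    refine h.trans ?_
    have hmpos : 0 < max |(AffineMap.lineMap x x' t : FreqBand) 0| (Λ / 2) := lt_max_of_lt_right (by positivity)
    have hfrac : 2 / max |(AffineMap.lineMap x x' t : FreqBand) 0| (Λ / 2) ≤ 2 / m₀ := div_le_div_of_nonneg_left (by norm_num) hm₀pos hmy
    rw [hK, show i + 1 + 1 = i + 2 by ring]
    exact mul_le_mul_of_nonneg_left (pow_le_pow_left₀ (by positivity) hfrac _) (by positivity)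
  exact (convex_segment x x').norm_image_sub_le_of_norm_fderiv_le (fun y _ => hdiff y) hseg
    (left_mem_segment ℝ x x') (right_mem_segment ℝ x x')

end Literature.MathematicalPhysics.QuantumLattice

end
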